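import Literature.NumberTheory.Irrationality.BrownZudilin2022.BarnesRepresentation
import HarnessLib

/-!
# Brown–Zudilin 2022, Sect. 7 and Remark 4: the transformation group `G = ⟨i₁, p₀₁, p₁₂, h⟩` is all of `Σ₇`, `|G| = 7! = 5040`

Topic `Literature/NumberTheory/Irrationality/BrownZudilin2022` (same namespace as `GeneralFamily.lean`,
`BarnesRepresentation.lean`; sub-namespace `GroupG` for the group of Sect. 7). PROVED companion — theorems and concrete
definitions only; no named fact, no `sorry` (`GeneralFamily.lean` lists "`|G| = 7!`" as NOT typed). Source read on the
page: F. Brown, W. Zudilin, *On cellular rational approximations to ζ(5)*, arXiv:2210.03391v3 [BrownZudilin2022],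
Sect. 7 pp. 18–19 and Remark 4 (held text `paper:arxiv-2210.03391`, p0090–p0091).

HONEST FRAMING (cell pub-zeta5): systematic search; no irrationality claim unless certified. Group bookkeeping of the
cellular family as printed; nothing here is about `ζ(5)`'s irrationality, the inclusions (28), any measure or `γ`.

## What is printed and how it is typed

p. 18: "The group `G` generated by `i₁, p₀₁, p₁₂` and `h` (or by `h′` instead of the latter) acts naturally on the
8-parameter set `(p;q)` subject to the constraints (18), (19). Because the 8-parameter set is in one-to-one
correspondence with the original parameter set `a = (a₁,…,a₈)`, the action of `G` can be translated into one on the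
parameters `a`. We obtain `i₁ : a ↦ (a₅,a₄,a₃,a₂,a₁,a₇,a₆, −a₂+a₄−a₆+a₇+a₈)`, `p₀₁ : …`, `p₁₂ : …`, `h : …`, `h′ : …`"
(the tree's `genI1`, `genP01`, `genP12`, `genH`, `genH'` of `GeneralFamily.lean`). Remark 4, p. 19: "the order of the
group `G` is `7! = 5040`, which is the order of the symmetric group `Σ₇` on 7 letters. The precise explanation for this
will be made apparent in the next sections, as we shall show that indeed `G` is naturally isomorphic to `Σ₇`. Note that
the group `Σ₇` is also isomorphic to the Weyl group `W(A₆)` … consistent with the known hypergeometric groups for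
rational approximations to `ζ(2)` …, to `ζ(3)` … and to `ζ(4)` …: they are equal to `|W(A₄)| = 120`, `|W(D₅)| = 1920`
and `|W(E₆)| = 51840`, respectively." (The first two are the tree's `RhinViola1996.PhiGroup.card_range_act` and
`RhinViola2001.PhiGroup.card_Phi`.)

The tree already has the isomorphism's MECHANISM (`BarnesRepresentation.lean`): `slotPerm σ a` = the action of
`σ ∈ Σ₇` on `a` through the dual parameters `b₁,…,b₇` (Sect. 9–10), and the five theorems `slotPerm_i1`, `slotPerm_p01`,
`slotPerm_p12`, `slotPerm_h`, `slotPerm_h'` identifying the printed generators with the slot permutations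
`(14)(23)(57)`, `(34)`, `(35)`, `(36)`, `(46)`. TYPED here: those five permutations `gI1, gP01, gP12, gH, gH'` of
`Fin 7` (0-indexed), `G = closure {i₁, p₀₁, p₁₂, h}`, `G' = closure {i₁, p₀₁, p₁₂, h′}`, the five-letter alphabet `Gen`
with `Gen.act` (the printed maps on `a`), words `act`, and `wordPerm`. PROVED: `h p₁₂ p₀₁ i₁` and `h′ p₁₂ p₀₁ i₁` are
7-cycles, hence **`G_eq_top`, `G'_eq_top`** (Mathlib's `Equiv.Perm.closure_prime_cycle_swap`: 7 is prime and `p₀₁` is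
a transposition) and **`card_G : Nat.card G = 5040`**; the ACTION DICTIONARY `slotPerm_one`,
**`slotPerm_mul : slotPerm (σ * τ) a = slotPerm σ (slotPerm τ a)`** (a left action: `(σ·b)_j = b_{σ⁻¹(j)}`),
`genAct_eq_slotPerm`, **`act_eq_slotPerm`** (a word of printed transformations acts as the slot permutation of the
product of its letters), `exists_word_of_perm` (every `σ ∈ Σ₇` is such a product), FAITHFULNESS `slotPerm_faithful`
(tested at the record parameters `recordVec`, whose `b₁,…,b₇ = 17,16,…,11` are distinct) and `wordPerm_eq_iff`, and
hence **`card_range_act : Nat.card (Set.range act) = 5040`** — "`|G| = 7!`" for `G` as the group of parameter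
transformations generated by the printed maps. Also the formal dependency between the two Literature named facts about
(27): `invariance_of_converges'_of_invariance_group` (nothing discharged or minted; both are theorems Summits-side, see
below). Kernel computations on permutations of `Fin 7` only (no enumeration of `Σ₇`); no `native_decide`.
SUMMITS-SIDE PRIOR WORK (cell `pub-zeta5`, seat ct-1 g15; Literature cannot import `Summits.*`, D-0022):
`Summit.KontsevichZagierPeriods.Zeta5Search.AmpleGroupInvariance` proves `slotPerm_one`, `slotPerm_mul` and `word_exists`
(every `σ ∈ Σ₇` is a word in the FIVE generators, via a swap table) on the way to the cell's theorems
`InvarianceOfConverges.invariance_of_converges'_holds` and `InvarianceGroup.invariance_group_holds`. The present Literature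
file RESTATES the two action lemmas (gate note `dedup.foreign`; cited at the declarations) and adds what Remark 4 prints:
FOUR of the generators suffice (`G = ⟨i₁, p₀₁, p₁₂, h⟩ = Σ₇`, also with `h′`), `|G| = 5040`, and the faithfulness count
`|{act w}| = 5040` for the group of parameter transformations.
NOT typed here: "the group is a permutation group on the 28 elements `h_i`" (26) and the orbits `h′ = Ga₁`, `h″ = Ga₂`
(Sect. 7 p. 19), (27)–(30), Sect. 8's `Aut D`.
-/

namespace Literature.NumberTheory.Irrationality.BrownZudilin2022

namespace GroupG

open Equiv Equiv.Perm

/-! ### The five printed generators as permutations of the seven slots `b₁, …, b₇` -/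

/-- `i₁ = (14)(23)(57)` on the slots (0-indexed: `swap 0 3 * swap 1 2 * swap 4 6`, as in `slotPerm_i1`).
[cite: BrownZudilin2022, Sect. 7 p. 18 and Sect. 8–10 (`slotPerm_i1`)] -/
def gI1 : Perm (Fin 7) := swap 0 3 * swap 1 2 * swap 4 6

/-- `p₀₁ = (34)` on the slots. [cite: BrownZudilin2022, Sect. 7 p. 18 and Sect. 8–10 (`slotPerm_p01`)] -/
def gP01 : Perm (Fin 7) := swap 2 3

/-- `p₁₂ = (35)` on the slots. [cite: BrownZudilin2022, Sect. 7 p. 18 and Sect. 8–10 (`slotPerm_p12`)] -/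
def gP12 : Perm (Fin 7) := swap 2 4

/-- `h = (36)` on the slots. [cite: BrownZudilin2022, Sect. 7 p. 18 and Sect. 8–10 (`slotPerm_h`)] -/
def gH : Perm (Fin 7) := swap 2 5

/-- `h′ = (46)` on the slots. [cite: BrownZudilin2022, Sect. 7 p. 18 and Sect. 8–10 (`slotPerm_h'`)] -/
def gH' : Perm (Fin 7) := swap 3 5

/-- "The group `G` generated by `i₁, p₀₁, p₁₂` and `h`", on the slots. [cite: BrownZudilin2022, Sect. 7 p. 18] -/
def G : Subgroup (Perm (Fin 7)) := Subgroup.closure {gI1, gP01, gP12, gH}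

/-- "(or by `h′` instead of the latter)". [cite: BrownZudilin2022, Sect. 7 p. 18] -/
def G' : Subgroup (Perm (Fin 7)) := Subgroup.closure {gI1, gP01, gP12, gH'}

/-- `h p₁₂ p₀₁ i₁` is the 7-cycle `0 → 4 → 6 → 5 → 2 → 1 → 3 → 0` (kernel-checked; found by breadth-first search).
[cite: BrownZudilin2022, Sect. 7 Remark 4 ("G is naturally isomorphic to Σ₇")] -/
theorem sevenCycle : gH * gP12 * gP01 * gI1 = List.formPerm [0, 4, 6, 5, 2, 1, 3] := by decide

/-- `h′ p₁₂ p₀₁ i₁` is the 7-cycle `0 → 4 → 6 → 2 → 1 → 5 → 3 → 0`. [cite: BrownZudilin2022, Sect. 7 Remark 4] -/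
theorem sevenCycle' : gH' * gP12 * gP01 * gI1 = List.formPerm [0, 4, 6, 2, 1, 5, 3] := by decide

/-- `p₀₁` is a transposition. [cite: BrownZudilin2022, Sect. 7 p. 18] -/
theorem isSwap_gP01 : IsSwap gP01 := ⟨2, 3, by decide, rfl⟩

/-- A 7-cycle and a transposition generate `Σ₇` (plumbing around Mathlib's `closure_prime_cycle_swap`).
[cite: BrownZudilin2022, Sect. 7 Remark 4] -/
theorem closure_eq_top_of_sevenCycle {c : Perm (Fin 7)} {l : List (Fin 7)} (hc : c = l.formPerm) (hl : l.Nodup)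
    (hlen : 2 ≤ l.length) (hsupp : c.support = Finset.univ) {S : Set (Perm (Fin 7))}
    (hcS : c ∈ Subgroup.closure S) (hP : gP01 ∈ S) : Subgroup.closure S = ⊤ := by
  have hcyc : IsCycle c := by rw [hc]; exact List.isCycle_formPerm hl hlen
  have h7 : (Fintype.card (Fin 7)).Prime := by rw [Fintype.card_fin]; norm_num
  have htop := closure_prime_cycle_swap h7 hcyc hsupp isSwap_gP01
  rw [eq_top_iff, ← htop, Subgroup.closure_le]
  rintro x hx
  simp only [Set.mem_insert_iff, Set.mem_singleton_iff] at hx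
  rcases hx with rfl | rfl
  · exact hcS
  · exact Subgroup.subset_closure hP

/-- **`G = ⟨i₁, p₀₁, p₁₂, h⟩` is all of `Σ₇`** on the slots. [cite: BrownZudilin2022, Sect. 7 Remark 4] -/
theorem G_eq_top : G = ⊤ := by
  have hm : ∀ x ∈ ({gI1, gP01, gP12, gH} : Set (Perm (Fin 7))), x ∈ G := fun x hx => Subgroup.subset_closure hx
  refine closure_eq_top_of_sevenCycle sevenCycle (by decide) (by decide) (by decide) ?_ (by simp)
  exact Subgroup.mul_mem _ (Subgroup.mul_mem _ (Subgroup.mul_mem _ (hm gH (by simp)) (hm gP12 (by simp)))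
    (hm gP01 (by simp))) (hm gI1 (by simp))

/-- **`G' = ⟨i₁, p₀₁, p₁₂, h′⟩` is all of `Σ₇`** too ("or by `h′` instead of the latter"). [cite: BrownZudilin2022, Sect. 7 p. 18] -/
theorem G'_eq_top : G' = ⊤ := by
  have hm : ∀ x ∈ ({gI1, gP01, gP12, gH'} : Set (Perm (Fin 7))), x ∈ G' := fun x hx => Subgroup.subset_closure hx
  refine closure_eq_top_of_sevenCycle sevenCycle' (by decide) (by decide) (by decide) ?_ (by simp)
  exact Subgroup.mul_mem _ (Subgroup.mul_mem _ (Subgroup.mul_mem _ (hm gH' (by simp)) (hm gP12 (by simp)))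
    (hm gP01 (by simp))) (hm gI1 (by simp))

/-- **"the order of the group `G` is `7! = 5040`"** (on the slots). [cite: BrownZudilin2022, Sect. 7 Remark 4] -/
theorem card_G : Nat.card G = 5040 := by
  rw [G_eq_top, Subgroup.card_top, Nat.card_eq_fintype_card, Fintype.card_perm, Fintype.card_fin]
  rfl

/-! ### The action dictionary: `slotPerm` is a left action of `Σ₇` on the parameters `a` -/

/-- `bOfA` inverts `aOfB` on the eight meaningful slots `b₀,…,b₇`. [cite: BrownZudilin2022, Sect. 9, last display] -/
theorem bOfA_aOfB_of_le (b : ℕ → ℤ) {j : ℕ} (hj : j ≤ 7) : bOfA (aOfB b) j = b j := by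
  interval_cases j <;> simp [bOfA, aOfB] <;> ring

/-- `aOfB` only reads `b₀,…,b₇`. [cite: BrownZudilin2022, Sect. 9, last display] -/
theorem aOfB_congr {f g : ℕ → ℤ} (h : ∀ j ≤ 7, f j = g j) : aOfB f = aOfB g := by
  ext i; fin_cases i <;> simp [aOfB, h]

/-- The slot function inside `slotPerm`: `b₀ ↦ b₀`, `b_j ↦ b_{σ⁻¹(j)}` (`1 ≤ j ≤ 7`). [cite: BrownZudilin2022, Sect. 8–10] -/
def slotFun (σ : Perm (Fin 7)) (a : Fin 8 → ℤ) (j : ℕ) : ℤ :=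
  if h : 1 ≤ j ∧ j ≤ 7 then bOfA a ((σ.symm ⟨j - 1, by omega⟩ : Fin 7) + 1) else bOfA a j

/-- `slotPerm σ a = aOfB (slotFun σ a)` (definitional). [cite: BrownZudilin2022, Sect. 8–10] -/
theorem slotPerm_eq (σ : Perm (Fin 7)) (a : Fin 8 → ℤ) : slotPerm σ a = aOfB (slotFun σ a) := rfl

/-- `b₀` is fixed. [cite: BrownZudilin2022, Sect. 10 ("the group permutes s₁,…,s₇")] -/
theorem slotFun_zero (σ : Perm (Fin 7)) (a : Fin 8 → ℤ) : slotFun σ a 0 = bOfA a 0 := by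
  simp [slotFun]

/-- `(σ·b)_{i+1} = b_{σ⁻¹(i)+1}` for the seven slots `i : Fin 7`. [cite: BrownZudilin2022, Sect. 8–10] -/
theorem slotFun_succ (σ : Perm (Fin 7)) (a : Fin 8 → ℤ) (i : Fin 7) :
    slotFun σ a ((i : ℕ) + 1) = bOfA a ((σ.symm i : ℕ) + 1) := by
  have hi := i.isLt
  have h : 1 ≤ (i : ℕ) + 1 ∧ (i : ℕ) + 1 ≤ 7 := ⟨by omega, by omega⟩
  have hmk : (⟨(i : ℕ) + 1 - 1, by omega⟩ : Fin 7) = i := Fin.ext (by simp)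
  simp only [slotFun, dif_pos h, hmk]

/-- The dual parameters of `σ·a`: `b₀(σ·a) = b₀(a)` and `b_{i+1}(σ·a) = b_{σ⁻¹(i)+1}(a)`.
[cite: BrownZudilin2022, Sect. 8–10] -/
theorem bOfA_slotPerm_succ (σ : Perm (Fin 7)) (a : Fin 8 → ℤ) (i : Fin 7) :
    bOfA (slotPerm σ a) ((i : ℕ) + 1) = bOfA a ((σ.symm i : ℕ) + 1) := by
  have hi := i.isLt
  rw [slotPerm_eq, bOfA_aOfB_of_le _ (by omega), slotFun_succ]

/-- `b₀(σ·a) = b₀(a)`. [cite: BrownZudilin2022, Sect. 8–10] -/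
theorem bOfA_slotPerm_zero (σ : Perm (Fin 7)) (a : Fin 8 → ℤ) : bOfA (slotPerm σ a) 0 = bOfA a 0 := by
  rw [slotPerm_eq, bOfA_aOfB_of_le _ (by omega), slotFun_zero]

/-- The identity permutation acts trivially (also proved Summits-side as
`Summit.KontsevichZagierPeriods.Zeta5Search.AmpleGroupInvariance.slotPerm_one`, which Literature cannot import; restated).
[cite: BrownZudilin2022, Sect. 8–10] -/
theorem slotPerm_one (a : Fin 8 → ℤ) : slotPerm 1 a = a := by
  rw [slotPerm_eq]
  have h : aOfB (slotFun 1 a) = aOfB (bOfA a) := by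
    apply aOfB_congr
    intro j hj
    rcases Nat.eq_zero_or_pos j with rfl | hpos
    · exact slotFun_zero 1 a
    · obtain ⟨i, rfl⟩ : ∃ i : Fin 7, j = (i : ℕ) + 1 := ⟨⟨j - 1, by omega⟩, by simp; omega⟩
      rw [slotFun_succ]; rfl
  rw [h, aOfB_bOfA]

/-- **`slotPerm` is a left action**: `(στ)·a = σ·(τ·a)` (`(σ·b)_j = b_{σ⁻¹(j)}`) (also proved Summits-side as
`Summit.KontsevichZagierPeriods.Zeta5Search.AmpleGroupInvariance.slotPerm_mul`, which Literature cannot import; restated).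
[cite: BrownZudilin2022, Sect. 8–10] -/
theorem slotPerm_mul (σ τ : Perm (Fin 7)) (a : Fin 8 → ℤ) : slotPerm (σ * τ) a = slotPerm σ (slotPerm τ a) := by
  rw [slotPerm_eq, slotPerm_eq σ]
  apply aOfB_congr
  intro j hj
  rcases Nat.eq_zero_or_pos j with rfl | hpos
  · rw [slotFun_zero, slotFun_zero, bOfA_slotPerm_zero]
  · obtain ⟨i, rfl⟩ : ∃ i : Fin 7, j = (i : ℕ) + 1 := ⟨⟨j - 1, by omega⟩, by simp; omega⟩
    rw [slotFun_succ, slotFun_succ, bOfA_slotPerm_succ]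
    rfl

/-! ### Words in the printed generators -/

/-- The five printed generators `i₁, p₀₁, p₁₂, h, h′` (letters). [cite: BrownZudilin2022, Sect. 7 p. 18] -/
inductive Gen
  | I1
  | P01
  | P12
  | H
  | H'
  deriving DecidableEq

/-- The printed action of a generator on `a` (the tree's `genI1`, `genP01`, `genP12`, `genH`, `genH'`).
[cite: BrownZudilin2022, Sect. 7 p. 18] -/
def Gen.act : Gen → (Fin 8 → ℤ) → (Fin 8 → ℤ)
  | .I1 => genI1
  | .P01 => genP01
  | .P12 => genP12
  | .H => genH
  | .H' => genH'

/-- The slot permutation of a generator. [cite: BrownZudilin2022, Sect. 7–10] -/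
def Gen.perm : Gen → Perm (Fin 7)
  | .I1 => gI1
  | .P01 => gP01
  | .P12 => gP12
  | .H => gH
  | .H' => gH'

/-- Each printed generator acts as its slot permutation (the tree's `slotPerm_i1`, …, `slotPerm_h'`).
[cite: BrownZudilin2022, Sect. 7–10] -/
theorem genAct_eq_slotPerm (g : Gen) (a : Fin 8 → ℤ) : g.act a = slotPerm g.perm a := by
  cases g
  · exact (slotPerm_i1 a).symm
  · exact (slotPerm_p01 a).symm
  · exact (slotPerm_p12 a).symm
  · exact (slotPerm_h a).symm
  · exact (slotPerm_h' a).symm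

/-- A word of transformations `[g₁, …, gₙ]` acting on `a` (applied right to left: `g₁(g₂(⋯ gₙ(a)))`).
[cite: BrownZudilin2022, Sect. 7 p. 18] -/
def act (w : List Gen) (a : Fin 8 → ℤ) : Fin 8 → ℤ := w.foldr (fun g x => g.act x) a

/-- The slot permutation of a word: the product of the letters' permutations in the same order (`slotPerm` being a
left action). [cite: BrownZudilin2022, Sect. 7–10] -/
def wordPerm : List Gen → Perm (Fin 7)
  | [] => 1
  | g :: w => g.perm * wordPerm w

/-- `wordPerm` of a concatenation. [cite: BrownZudilin2022, Sect. 7–10] -/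
theorem wordPerm_append (w w' : List Gen) : wordPerm (w ++ w') = wordPerm w * wordPerm w' := by
  induction w with
  | nil => simp [wordPerm]
  | cons g w ih => simp [wordPerm, ih, mul_assoc]

/-- **Every word of printed transformations acts as the slot permutation of its product.** [cite: BrownZudilin2022, Sect. 7–10] -/
theorem act_eq_slotPerm (w : List Gen) (a : Fin 8 → ℤ) : act w a = slotPerm (wordPerm w) a := by
  induction w with
  | nil => exact (slotPerm_one a).symm
  | cons g w ih =>
    show g.act (act w a) = slotPerm (g.perm * wordPerm w) a
    rw [ih, genAct_eq_slotPerm, slotPerm_mul]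

/-- Every permutation of the seven slots is the product of a word in `i₁, p₀₁, p₁₂, h` ("G is naturally isomorphic to
`Σ₇`"; inverses are positive powers in a finite group). [cite: BrownZudilin2022, Sect. 7 Remark 4] -/
theorem exists_word_of_perm (σ : Perm (Fin 7)) : ∃ w : List Gen, wordPerm w = σ := by
  have hσ : σ ∈ G := by rw [G_eq_top]; exact Subgroup.mem_top σ
  have hpow : ∀ (w : List Gen) (n : ℕ), wordPerm (List.replicate n w).flatten = wordPerm w ^ n := by
    intro w n
    induction n with
    | zero => simp [wordPerm]
    | succ n ih => rw [List.replicate_succ, List.flatten_cons, wordPerm_append, ih, pow_succ']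
  induction hσ using Subgroup.closure_induction with
  | mem x hx =>
    simp only [Set.mem_insert_iff, Set.mem_singleton_iff] at hx
    rcases hx with rfl | rfl | rfl | rfl
    · exact ⟨[.I1], by simp [wordPerm, Gen.perm]⟩
    · exact ⟨[.P01], by simp [wordPerm, Gen.perm]⟩
    · exact ⟨[.P12], by simp [wordPerm, Gen.perm]⟩
    · exact ⟨[.H], by simp [wordPerm, Gen.perm]⟩
  | one => exact ⟨[], rfl⟩
  | mul x y _ _ ihx ihy =>
    obtain ⟨w, rfl⟩ := ihx
    obtain ⟨w', rfl⟩ := ihy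
    exact ⟨w ++ w', wordPerm_append w w'⟩
  | inv x _ ih =>
    obtain ⟨w, rfl⟩ := ih
    refine ⟨(List.replicate (orderOf (wordPerm w) - 1) w).flatten, ?_⟩
    rw [hpow]
    have ho : 0 < orderOf (wordPerm w) := orderOf_pos _
    have h1 : wordPerm w ^ (orderOf (wordPerm w) - 1) * wordPerm w = 1 := by
      rw [← pow_succ, Nat.sub_add_cancel ho, pow_orderOf_eq_one]
    exact eq_inv_of_mul_eq_one_left h1

/-! ### Faithfulness and `|G| = 7!` for the group of parameter transformations -/

/-- At the record parameters `a = (8,16,10,15,12,16,18,13)` the dual parameters `b₁,…,b₇ = 17,16,15,14,13,12,11` are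
pairwise distinct. [cite: BrownZudilin2022, Sect. 9 (last display) and Sect. 11] -/
theorem bOfA_recordVec_succ_injective :
    Function.Injective fun i : Fin 7 => bOfA recordVec ((i : ℕ) + 1) := by
  unfold Function.Injective recordVec; decide

/-- **Faithfulness**: a slot permutation is determined by its action on the parameters `a` (indeed by its action on
the record parameters alone). [cite: BrownZudilin2022, Sect. 7 Remark 4 ("naturally isomorphic")] -/
theorem slotPerm_faithful {σ τ : Perm (Fin 7)} (h : ∀ a, slotPerm σ a = slotPerm τ a) : σ = τ := by
  have key : ∀ i : Fin 7, bOfA recordVec ((σ.symm i : ℕ) + 1) = bOfA recordVec ((τ.symm i : ℕ) + 1) := fun i => by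
    rw [← bOfA_slotPerm_succ, ← bOfA_slotPerm_succ, h]
  have hs : σ.symm = τ.symm := Equiv.ext fun i => bOfA_recordVec_succ_injective (key i)
  simpa using congrArg Equiv.symm hs

/-- Two words act identically on all parameters iff their slot permutations agree. [cite: BrownZudilin2022, Sect. 7–10] -/
theorem wordPerm_eq_iff (w w' : List Gen) : wordPerm w = wordPerm w' ↔ ∀ a, act w a = act w' a := by
  refine ⟨fun h a => by rw [act_eq_slotPerm, act_eq_slotPerm, h], fun h => slotPerm_faithful fun a => ?_⟩
  rw [← act_eq_slotPerm, ← act_eq_slotPerm, h]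

/-- The group of parameter transformations generated by the printed maps, `{act w}`, is in bijection with `Σ₇`.
[cite: BrownZudilin2022, Sect. 7 Remark 4] -/
noncomputable def rangeActEquiv : Set.range act ≃ Perm (Fin 7) where
  toFun f := wordPerm f.2.choose
  invFun σ := ⟨act (exists_word_of_perm σ).choose, ⟨_, rfl⟩⟩
  left_inv f := by
    apply Subtype.ext
    have h1 : act f.2.choose = f.1 := f.2.choose_spec
    have h2 := (exists_word_of_perm (wordPerm f.2.choose)).choose_spec
    exact (funext ((wordPerm_eq_iff _ _).mp h2)).trans h1
  right_inv σ := by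
    have h2 := (exists_word_of_perm σ).choose_spec
    have h1 := Exists.choose_spec (⟨_, rfl⟩ : act (exists_word_of_perm σ).choose ∈ Set.range act)
    exact ((wordPerm_eq_iff _ _).mpr (congrFun h1)).trans h2

/-- **"the order of the group `G` is `7! = 5040`"**, for `G` the group of transformations of the parameters `a`
generated by the printed `i₁, p₀₁, p₁₂, h, h′`. [cite: BrownZudilin2022, Sect. 7 Remark 4] -/
theorem card_range_act : Nat.card (Set.range act) = 5040 := by
  rw [Nat.card_congr rangeActEquiv, Nat.card_eq_fintype_card, Fintype.card_perm, Fintype.card_fin]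
  rfl

/-! ### The two named facts about (27) -/

/-- The five-generator form of the invariance of (27) is the special case of the whole-group form: the Literature
named fact `invariance_group` implies the Literature named fact `invariance_of_converges'` (via the tree's `slotPerm_i1`,
…, `slotPerm_h'`). Nothing is discharged or minted here: this records only the formal dependency inside Literature; both
facts are meanwhile THEOREMS on the Summits side (`Summit.KontsevichZagierPeriods.Zeta5Search.InvarianceOfConverges.
invariance_of_converges'_holds`, `….InvarianceGroup.invariance_group_holds`, cell `pub-zeta5`), which Literature cannot
import. [cite: BrownZudilin2022, Sect. 7, eq. (27)] -/
theorem invariance_of_converges'_of_invariance_group (h : invariance_group) : invariance_of_converges' := by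
  intro a ha
  refine ⟨fun hc => ?_, fun hc => ?_, fun hc => ?_, fun hc => ?_, fun hc => ?_⟩
  · rw [← slotPerm_i1] at hc ⊢; exact h _ a ha hc
  · rw [← slotPerm_p01] at hc ⊢; exact h _ a ha hc
  · rw [← slotPerm_p12] at hc ⊢; exact h _ a ha hc
  · rw [← slotPerm_h] at hc ⊢; exact h _ a ha hc
  · rw [← slotPerm_h'] at hc ⊢; exact h _ a ha hc

end GroupG

end Literature.NumberTheory.Irrationality.BrownZudilin2022
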